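import Summits.QuantumAdvantage.QuantumAdvantage.Theorems.WalkTwoStepSparsePinnedPart

/-!
# (G♯) local engine — `SparsePinned p` PROVED, part 3/3: the per-fibre bound `fibre_bound_part`, `sparsePinned_of_prime` (every prime `p ≥ 5`) and `sparsePinned_five : SparsePinned 5`

# (G♯) local engine — the sparse pinned branch `SparsePinned p` PROVED (every prime `p ≥ 5`)

Cell qa-qnc0, rung (G♯) = item stmt-QuantumAdvantage-23121 `OddPrimeWalk.TwoStepFreeRungFive` (planner qa-qnc0-p2 g24, ask P2-24b,
ROUND-24 §1ter REVISION (h) audit "TRUE as typed"); prover qn-prover-3 g15.  One of the three OPEN regime lemmas of the checked skeleton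
`WalkTwoStepLocalEngine{Core,Regimes,Glue}.lean` (`twoStepFreeRungFive_of : FarLocal 5 → SparsePinned 5 → DensePinned 5 → …`).

STATEMENT (`LocalEngine.SparsePinned p`, verbatim from the skeleton): for every `ε > 0` there is a window length `m` such that for every
two-step free-split strategy `S`, class `w`, pin datum `(d₀, u₀)` and charge `c`, if `(2·effOn + #pinTimes + 2p + 1)·m ≤ n` then the part
`Q = part S d₀ w u₀` satisfies `#winPart ≤ (2/3 + ε)·#Q`.

PROOF (port of rung (G)'s window branch `RungG.stub_sparse` / `fibre_bound`, with two additions).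
* §A two-step forms on a glued input `uA ++ v ++ uB` (`CleanGapStrategies.glue3`): a cut whose position and split both avoid the OPEN
  window has fire bit / live bit / status equal to explicit functions `fireR / liveR / statusR` of the window residue `r = wt v (mod 3p)`
  (`RungG.liftOf`, `RungG.stateOf`); passing to the lift `r + j·p` keeps `fireR` and twists the phase by `p` (cuts `≤ a`) or `2p`
  (cuts `> a`), so by `Coset21.twistedNotAllThree` the three lifts of a residue mod `p` do NOT all win (`not_winE_all_three`).
* §B the part on a fibre: with the window inside `[p, n − p)` and no pin time strictly inside it, membership of `uA ++ v ++ uB` in `Q`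
  depends on `v` only through `wt v (mod p)` (`mem_part_glue3_of_wt_eq`), so the fibre of `Q` is empty or a full residue class mod `p`.
* §C (new) cuts that are NOT effective on `Q` have status identically `false` on `Q`: a second, `g`-free window and the three lifts
  rotate the phase of `g` through all of `ℤ₃` inside `Q` (`exists_status_false`), so a constant status is the constant `false`.  (Without
  this the parity argument would only bound the effective cuts' contribution up to an unknown constant.)
* §D pigeonhole for a free window among `2·effOn + #pinTimes + 1` candidates inside `[p, n − p)`, the per-fibre bound (the arithmetic of
  `RungG.fibre_bound` verbatim, `RungG.stub_equidist` at modulus `3p`), Fubini `card_filter_eq_sum_glue3`; `sparsePinned_of_prime`,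
  `sparsePinned_five : SparsePinned 5`.

WHAT THIS IS NOT: `FarLocal` and `DensePinned` stay open (so (G♯) is not yet proved); nothing about `LinSel`/R5; separation NOT moved.

This file: the rest of §D.  Parts 1/3, 2/3: `WalkTwoStepSparsePinnedFibre.lean`, `WalkTwoStepSparsePinnedPart.lean`.
-/

namespace Summit.QuantumAdvantage.AdviceFreeQNC0.LocalEngine
open Finset Classical
open Summit.QuantumAdvantage.AdviceFreeQNC0.Coset21 (twistedNotAllThree)
open Summit.QuantumAdvantage.AdviceFreeQNC0.Coset21.RungG (classOf proj proj_natCast liftOf stateOf liftOf_glue3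
  stateOf_glue3 cast3_val_add_nat exists_lift_eq proj_lift Equidist stub_equidist mod_three_of_mod)

/-! ### §D (continued) The per-fibre bound and `SparsePinned p` -/

section Main

variable {p : ℕ} {M : ℕ}

variable {a q : ℕ}

/-- **Per-fibre bound** (the arithmetic of `RungG.fibre_bound`): on the fibre `(uA, uB)` of an admissible free window,
`#(win ∩ Q) ≤ (2/3 + ε)·#Q`. -/
theorem fibre_bound_part [Fact p.Prime] (hM : M + 1 = 3 * p) (hp3 : ¬ 3 ∣ p) {m : ℕ} (hm : 0 < m) (c d₀ : ℕ)
    (S : TwoStep p (a + m + q)) (w : ZMod p) (u₀ : Fin (a + m + q) → Bool)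
    (hpa : p ≤ a) (hpq : p ≤ q) (hpins : ∀ τ ∈ pinTimes S d₀, τ.val ≤ a ∨ a + m ≤ τ.val)
    (Eff : Finset (Fin (a + m + q + 1)))
    (hEff : ∀ g ∈ Eff, (g.val ≤ a ∨ a + m ≤ g.val) ∧ (S.s g ≤ a ∨ a + m ≤ S.s g))
    (hnon : ∀ g, g ∉ Eff → ∀ u ∈ part S d₀ w u₀, status c S g u = false)
    (uA : Fin a → Bool) (uB : Fin q → Bool) (ρ ε : ℝ) (hρ : 0 ≤ ρ) (hε : 0 < ε) (hε3 : ε ≤ 1 / 3)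
    (hE : ∀ r : ZMod (M + 1),
      |((((univ : Finset (Fin m → Bool)).filter fun v => ((wt v : ℕ) : ZMod (M + 1)) = r).card : ℕ) : ℝ)
          - (2 : ℝ) ^ m / ((M + 1 : ℕ) : ℝ)| ≤ ρ ^ m * (2 : ℝ) ^ m)
    (hρm : 2 * p * ρ ^ m ≤ ε) :
    (((univ : Finset (Fin m → Bool)).filter fun v =>
        glue3 uA v uB ∈ part S d₀ w u₀ ∧ ringWinU c S.y (glue3 uA v uB) = true).card : ℝ)
      ≤ (2 / 3 + ε) * (((univ : Finset (Fin m → Bool)).filter fun v =>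
          glue3 uA v uB ∈ part S d₀ w u₀).card : ℝ) := by
  haveI : NeZero p := ⟨(Fact.out : p.Prime).ne_zero⟩
  have hp_pos : 0 < p := (Fact.out : p.Prime).pos
  set Q := part S d₀ w u₀ with hQdef
  set Qfib := (univ : Finset (Fin m → Bool)).filter fun v => glue3 uA v uB ∈ Q with hQfib
  set WN := (univ : Finset (Fin m → Bool)).filter fun v =>
    glue3 uA v uB ∈ Q ∧ ringWinU c S.y (glue3 uA v uB) = true with hWN
  have hWNQ : WN ⊆ Qfib := by
    intro v hv
    rw [hWN, Finset.mem_filter] at hv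
    rw [hQfib, Finset.mem_filter]
    exact ⟨hv.1, hv.2.1⟩
  by_cases hne : Qfib = ∅
  · have h0 : WN = ∅ := Finset.subset_empty.mp (hne ▸ hWNQ)
    rw [h0, hne]
    simp
  obtain ⟨v₁, hv₁⟩ := Finset.nonempty_iff_ne_empty.mpr hne
  have hv₁Q : glue3 uA v₁ uB ∈ Q := by rw [hQfib, Finset.mem_filter] at hv₁; exact hv₁.2
  -- the residue `k₀` forced on the window weight, and its lifts `L j`
  set k₀ : ZMod p := w - ((wt uA : ℕ) : ZMod p) - ((wt uB : ℕ) : ZMod p) with hk₀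
  set L : ℕ → ZMod (M + 1) := fun j => ((k₀.val : ℕ) : ZMod (M + 1)) + ((j * p : ℕ) : ZMod (M + 1)) with hL
  set N : ZMod (M + 1) → ℕ := fun r => ((univ : Finset (Fin m → Bool)).filter fun v => ((wt v : ℕ) : ZMod (M + 1)) = r).card
    with hN
  set CL := (univ : Finset (Fin m → Bool)).filter fun v => proj hM (((wt v : ℕ) : ZMod (M + 1))) = k₀ with hCL
  -- the fibre of the part is the full residue class `CL`
  have hk₁ : ((wt v₁ : ℕ) : ZMod p) = k₀ := wt_window_eq_of_mem_part S d₀ w u₀ uA uB v₁ hv₁Q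
  have hQCL : Qfib = CL := by
    ext v
    rw [hQfib, hCL, Finset.mem_filter, Finset.mem_filter, proj_natCast]
    constructor
    · intro hv; exact ⟨Finset.mem_univ _, wt_window_eq_of_mem_part S d₀ w u₀ uA uB v hv.2⟩
    · intro hv
      refine ⟨Finset.mem_univ _, ?_⟩
      exact mem_part_glue3_of_wt_eq S d₀ w u₀ hpa hpq hpins uA uB v₁ v (by rw [hk₁, hv.2]) hv₁Q
  -- WIN on the fibre of the part is `WinE` of the window weight
  have hwinE : ∀ v, glue3 uA v uB ∈ Q →
      (ringWinU c S.y (glue3 uA v uB) = true ↔ WinE hM m c S Eff uA uB ((wt v : ℕ) : ZMod (M + 1))) := by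
    intro v hv
    rw [ringWinU_eq_true_iff_odd_status]
    unfold WinE
    have hset : (univ.filter fun g : Fin (a + m + q + 1) => status c S g (glue3 uA v uB) = true)
        = Eff.filter fun g => statusR hM m c S uA uB g ((wt v : ℕ) : ZMod (M + 1)) = true := by
      ext g
      rw [Finset.mem_filter, Finset.mem_filter]
      constructor
      · intro hg
        have hgE : g ∈ Eff := by
          by_contra hgE
          have := hnon g hgE _ hv
          rw [this] at hg
          exact Bool.false_ne_true hg.2
        exact ⟨hgE, by rw [← status_glue3_eq_statusR hM hm c S uA v uB g (hEff g hgE).1 (hEff g hgE).2]; exact hg.2⟩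
      · intro hg
        exact ⟨Finset.mem_univ _, by rw [status_glue3_eq_statusR hM hm c S uA v uB g (hEff g hg.1).1 (hEff g hg.1).2]; exact hg.2⟩
    rw [hset]
  -- (1) `#CL ≤ Σ_{j<3} N (L j)`
  have hCLsub : CL ⊆ (Finset.range 3).biUnion fun j => (univ : Finset (Fin m → Bool)).filter fun v =>
      ((wt v : ℕ) : ZMod (M + 1)) = L j := by
    intro v hv
    rw [hCL, Finset.mem_filter] at hv
    obtain ⟨j, hj, hjr⟩ := exists_lift_eq hM k₀ _ hv.2
    rw [Finset.mem_biUnion]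
    exact ⟨j, Finset.mem_range.mpr hj, by rw [Finset.mem_filter]; exact ⟨Finset.mem_univ _, hjr⟩⟩
  have hCLle : (CL.card : ℝ) ≤ (N (L 0) : ℝ) + N (L 1) + N (L 2) := by
    have h := (Finset.card_le_card hCLsub).trans Finset.card_biUnion_le
    simp only [Finset.sum_range_succ, Finset.sum_range_zero, zero_add] at h
    exact_mod_cast h
  -- (2) a non-winning lift `L j₀` and `#win ≤ #CL − N (L j₀)`
  have hnot := not_winE_all_three hM hp3 m c S Eff uA uB ((k₀.val : ℕ) : ZMod (M + 1))
  simp only [not_forall] at hnot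
  obtain ⟨j₀, hj₀, hW₀⟩ := hnot
  set S₀ := (univ : Finset (Fin m → Bool)).filter fun v => ((wt v : ℕ) : ZMod (M + 1)) = L j₀ with hS₀
  have hS₀sub : S₀ ⊆ CL := by
    intro v hv
    rw [hS₀, Finset.mem_filter] at hv
    rw [hCL, Finset.mem_filter]
    refine ⟨Finset.mem_univ _, ?_⟩
    rw [hv.2]; exact proj_lift hM k₀ j₀
  have hWNsub : WN ⊆ CL \ S₀ := by
    intro v hv
    have hvQ : v ∈ Qfib := hWNQ hv
    rw [hWN, Finset.mem_filter] at hv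
    rw [Finset.mem_sdiff]
    refine ⟨hQCL ▸ hvQ, ?_⟩
    intro hv0
    rw [hS₀, Finset.mem_filter] at hv0
    have hwin := (hwinE v hv.2.1).mp hv.2.2
    rw [hv0.2] at hwin
    exact hW₀ hwin
  have hWNle : (WN.card : ℝ) ≤ (CL.card : ℝ) - N (L j₀) := by
    have h1 : WN.card ≤ CL.card - S₀.card := by
      calc WN.card ≤ (CL \ S₀).card := Finset.card_le_card hWNsub
        _ = CL.card - S₀.card := Finset.card_sdiff_of_subset hS₀sub
    have h2 : S₀.card ≤ CL.card := Finset.card_le_card hS₀sub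
    have h3 : (WN.card : ℝ) ≤ ((CL.card - S₀.card : ℕ) : ℝ) := by exact_mod_cast h1
    rw [Nat.cast_sub h2] at h3
    exact h3
  -- (3) the Equidist counts
  set X : ℝ := (2 : ℝ) ^ m / ((M + 1 : ℕ) : ℝ) with hX
  set E : ℝ := ρ ^ m * (2 : ℝ) ^ m with hEdef
  have hNlo : ∀ r, X - E ≤ (N r : ℝ) := fun r => by have := (abs_le.mp (hE r)).1; simp only [hN]; linarith
  have hNhi : ∀ r, (N r : ℝ) ≤ X + E := fun r => by have := (abs_le.mp (hE r)).2; simp only [hN]; linarith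
  have hEnn : 0 ≤ E := by positivity
  have hXval : X = (2 : ℝ) ^ m / (3 * p) := by rw [hX, hM]; push_cast; ring
  have hE2 : 2 * E ≤ 3 * ε * X := by
    rw [hXval, hEdef]
    have h2m : (0 : ℝ) < (2 : ℝ) ^ m := by positivity
    have hp' : (0 : ℝ) < p := by exact_mod_cast hp_pos
    have := mul_le_mul_of_nonneg_right hρm h2m.le
    rw [show 3 * ε * ((2 : ℝ) ^ m / (3 * p)) = ε * (2 : ℝ) ^ m / p by field_simp]
    rw [le_div_iff₀ hp']
    nlinarith
  have hC3 : (CL.card : ℝ) ≤ 3 * (X + E) := by linarith [hCLle, hNhi (L 0), hNhi (L 1), hNhi (L 2)]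
  have hW : (WN.card : ℝ) ≤ (CL.card : ℝ) - X + E := by linarith [hWNle, hNlo (L j₀)]
  have hCnn : (0 : ℝ) ≤ CL.card := by positivity
  have h13 : (0 : ℝ) ≤ 1 / 3 - ε := by linarith
  rw [hQCL]
  nlinarith [mul_nonneg h13 (by linarith : (0 : ℝ) ≤ 3 * (X + E) - CL.card), mul_nonneg hε.le hEnn]

/-- **`SparsePinned p` for every prime `p ≥ 5`** (the sparse pinned branch of the (G♯) engine). -/
theorem sparsePinned_of_prime (p : ℕ) [Fact p.Prime] (hp : 5 ≤ p) : SparsePinned p := by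
  intro ε hε
  have hM : 3 * p - 1 + 1 = 3 * p := by omega
  have hp3 : ¬ 3 ∣ p := by
    intro h
    have := (Nat.Prime.eq_one_or_self_of_dvd (Fact.out : p.Prime) 3 h)
    omega
  have hp_pos : 0 < p := by omega
  obtain ⟨ρ, hρ0, hρ1, hEq⟩ := stub_equidist (3 * p - 1 + 1) (by omega)
  -- work with `ε' = min ε (1/3)`
  set ε' : ℝ := min ε (1 / 3) with hε'
  have hε'0 : 0 < ε' := lt_min hε (by norm_num)
  have hε'3 : ε' ≤ 1 / 3 := min_le_right _ _
  have hε'le : ε' ≤ ε := min_le_left _ _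
  -- window lengths: `m₁` for the counting, `m₂ = 3p` for the three lifts, `m = m₁ + 2 m₂ + 1` for the pigeonhole
  have hp' : (0 : ℝ) < p := by exact_mod_cast hp_pos
  obtain ⟨m₀, hm₀⟩ := exists_pow_lt_of_lt_one (show (0 : ℝ) < ε' / (2 * p) by positivity) hρ1
  set m₁ := m₀ + 1 with hm₁
  have hρm : 2 * p * ρ ^ m₁ ≤ ε' := by
    have h1 : ρ ^ (m₀ + 1) ≤ ρ ^ m₀ := by
      rw [pow_succ]; exact mul_le_of_le_one_right (pow_nonneg hρ0 _) hρ1.le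
    have h2 : ρ ^ (m₀ + 1) < ε' / (2 * p) := h1.trans_lt hm₀
    rw [lt_div_iff₀ (by positivity)] at h2
    rw [hm₁]; linarith
  set m₂ := 3 * p with hm₂
  set m := m₁ + 2 * m₂ + 1 with hmdef
  refine ⟨m, by omega, fun n c d₀ S w u₀ hroom => ?_⟩
  set Q := part S d₀ w u₀ with hQdef
  -- effective cuts and obstacles
  set EffSet := (univ : Finset (Fin (n + 1))).filter fun g => ∃ u ∈ Q, ∃ v ∈ Q, status c S g u ≠ status c S g v with hEffSet
  have hEcard : EffSet.card = effOn c S Q := by rw [hEffSet]; unfold effOn; rfl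
  set O : Finset ℕ := (EffSet.image fun g => g.val) ∪ (EffSet.image fun g => S.s g) ∪ ((pinTimes S d₀).image fun τ => τ.val)
    with hO
  have hOcard : O.card < 2 * effOn c S Q + (pinTimes S d₀).card + 1 := by
    rw [hO]
    have h1 := Finset.card_union_le ((EffSet.image fun g => g.val) ∪ (EffSet.image fun g => S.s g)) ((pinTimes S d₀).image fun τ => τ.val)
    have h2 := Finset.card_union_le (EffSet.image fun g => g.val) (EffSet.image fun g => S.s g)
    have h3 : (EffSet.image fun g => g.val).card ≤ EffSet.card := Finset.card_image_le
    have h4 : (EffSet.image fun g => S.s g).card ≤ EffSet.card := Finset.card_image_le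
    have h5 : ((pinTimes S d₀).image fun τ => τ.val).card ≤ (pinTimes S d₀).card := Finset.card_image_le
    omega
  -- the free window `[a, a + m)` inside `[p, n - p)`
  obtain ⟨j, hj, hjO⟩ := exists_window_avoiding O (lo := p) (m := m) (by omega) hOcard
  obtain ⟨a, hpa, han, haO⟩ : ∃ a, p ≤ a ∧ a + m + p ≤ n ∧ ∀ x ∈ O, ¬ (a < x ∧ x < a + m) := by
    refine ⟨p + j * m, by omega, ?_, hjO⟩
    have h1 : j * m + m ≤ (2 * effOn c S Q + (pinTimes S d₀).card) * m + m := by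
      have := Nat.mul_le_mul_right m (show j ≤ 2 * effOn c S Q + (pinTimes S d₀).card by omega)
      omega
    have h2 : 2 * p ≤ 2 * p * m := Nat.le_mul_of_pos_right _ (by omega)
    have h3 : (2 * effOn c S Q + (pinTimes S d₀).card + 2 * p + 1) * m
        = (2 * effOn c S Q + (pinTimes S d₀).card) * m + 2 * p * m + m := by ring
    omega
  have hpinsW : ∀ τ ∈ pinTimes S d₀, τ.val ≤ a ∨ a + m ≤ τ.val := by
    intro τ hτ
    have hx : τ.val ∈ O := by
      rw [hO]; exact Finset.mem_union_right _ (Finset.mem_image_of_mem _ hτ)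
    have := haO _ hx
    omega
  -- non-effective cuts have status `false` on the part (two `g`-free sub-windows of length `m₂`)
  have hnon : ∀ g : Fin (n + 1), g ∉ EffSet → ∀ u ∈ Q, status c S g u = false := by
    intro g hg
    have hne : ¬ ∃ u ∈ Q, ∃ v ∈ Q, status c S g u ≠ status c S g v := by
      intro h; apply hg; rw [hEffSet, Finset.mem_filter]; exact ⟨Finset.mem_univ _, h⟩
    by_cases hgpos : g.val ≤ a ∨ a + m₂ ≤ g.val
    · exact status_eq_false_of_not_eff hp3 c d₀ S w u₀ g a m₂ le_rfl hpa (by omega)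
        (fun τ hτ => by rcases hpinsW τ hτ with h | h; exact Or.inl h; exact Or.inr (by omega)) hgpos hne
    · exact status_eq_false_of_not_eff hp3 c d₀ S w u₀ g (a + m₂ + 1) m₂ le_rfl (by omega) (by omega)
        (fun τ hτ => by rcases hpinsW τ hτ with h | h; exact Or.inl (by omega); exact Or.inr (by omega))
        (by omega) hne
  have hEff : ∀ g ∈ EffSet, (g.val ≤ a ∨ a + m₁ ≤ g.val) ∧ (S.s g ≤ a ∨ a + m₁ ≤ S.s g) := by
    intro g hg
    have hx1 : g.val ∈ O := by
      rw [hO]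
      exact Finset.mem_union_left _ (Finset.mem_union_left _ (Finset.mem_image_of_mem _ hg))
    have hx2 : S.s g ∈ O := by
      rw [hO]
      exact Finset.mem_union_left _ (Finset.mem_union_right _ (Finset.mem_image_of_mem (fun g => S.s g) hg))
    have h1 := haO _ hx1
    have h2 := haO _ hx2
    constructor <;> omega
  have hpins₁ : ∀ τ ∈ pinTimes S d₀, τ.val ≤ a ∨ a + m₁ ≤ τ.val := by
    intro τ hτ; rcases hpinsW τ hτ with h | h; exact Or.inl h; exact Or.inr (by omega)
  -- decompose `n = a + m₁ + q`
  obtain ⟨q, hq⟩ : ∃ q, n = a + m₁ + q := ⟨n - (a + m₁), by omega⟩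
  have hpq : p ≤ q := by omega
  subst hq
  -- both counts over the fibres `(uA, uB)`
  have hwin : (winPart c S d₀ w u₀).card = ∑ uA : Fin a → Bool, ∑ uB : Fin q → Bool,
      ((univ : Finset (Fin m₁ → Bool)).filter fun v =>
        glue3 uA v uB ∈ Q ∧ ringWinU c S.y (glue3 uA v uB) = true).card := by
    have e : winPart c S d₀ w u₀ = univ.filter fun u => u ∈ Q ∧ ringWinU c S.y u = true := by
      ext u; unfold winPart; rw [hQdef, Finset.mem_filter, Finset.mem_filter]; simp
    rw [e]
    exact card_filter_eq_sum_glue3 _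
  have hcl : Q.card = ∑ uA : Fin a → Bool, ∑ uB : Fin q → Bool,
      ((univ : Finset (Fin m₁ → Bool)).filter fun v => glue3 uA v uB ∈ Q).card := by
    have e : Q = univ.filter fun u => u ∈ Q := by ext u; simp
    conv_lhs => rw [e]
    exact card_filter_eq_sum_glue3 _
  rw [hwin, hcl]
  push_cast
  rw [Finset.mul_sum]
  refine Finset.sum_le_sum fun uA _ => ?_
  rw [Finset.mul_sum]
  refine Finset.sum_le_sum fun uB _ => ?_
  have hfib := fibre_bound_part hM hp3 (by omega : 0 < m₁) c d₀ S w u₀ hpa hpq hpins₁ EffSet hEff hnon uA uB ρ ε'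
    hρ0 hε'0 hε'3 (hEq m₁) hρm
  refine hfib.trans ?_
  have hnn : (0 : ℝ) ≤ (((univ : Finset (Fin m₁ → Bool)).filter fun v => glue3 uA v uB ∈ Q).card : ℝ) :=
    Nat.cast_nonneg _
  nlinarith [mul_le_mul_of_nonneg_right hε'le hnn]

/-- **`SparsePinned 5`** — the sparse pinned branch of the (G♯) skeleton at `p = 5`, the hypothesis `h₂` of
`twoStepFreeRungFive_of` (item stmt-QuantumAdvantage-23121). -/
theorem sparsePinned_five : SparsePinned 5 :=
  haveI : Fact (Nat.Prime 5) := ⟨by norm_num⟩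
  sparsePinned_of_prime 5 le_rfl

end Main

end Summit.QuantumAdvantage.AdviceFreeQNC0.LocalEngine
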